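import Summits.QuantumFields.YangMills.Theorems.ColdStartUniversalityLatticeLangevinStrongMarkovCountable
import HarnessLib

/-!
# Route `ColdStartUniversality` (fixed-cut-off SZZ dynamics): ★★★ THE STRONG MARKOV PROPERTY OF STRONG SOLUTIONS —
# `E[Z · G(U_(τ+t))] = E[Z · (κ_t G)(U_τ)]` at EVERY finite stopping time `τ` of the driving filtration, `Z` `𝓕_τ`-measurable

Helper file (seat `ym-line-csu-p1`, g33; `--supports stmt-QuantumFields-24809`).  The countable case (file 57) upgrades to ARBITRARY finite stopping
times by the dyadic approximation FROM ABOVE already used for deterministic times (file 44): `τ_n = (⌊2^n τ⌋ + 1)/2^n` is a countably-valued stopping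
time with `τ ≤ τ_n ≤ τ + 2^(−n)` (so `𝓕_τ ≤ 𝓕_(τ_n)` and `Z` stays admissible), file 57 applies at `τ_n`, and `n → ∞` by a.s. path continuity and the
Feller property for continuous `G`; bounded measurable `G` by identification of the two finite measures `(Z·P)∘U_(τ+t)⁻¹` and `κ_t ∘ₘ (Z·P)∘U_τ⁻¹`.
For every strong solution `U` of the SU(2) SZZ dynamics from a deterministic start on ANY probability space and every realising kernel family `κ`:
* `isStoppingTime_dyadicCeil` — `τ_n` is a stopping time whenever `τ` is;
* `aemeasurable_comp_stoppingTime_add` — `ω ↦ U_(τ(ω)+t)(ω)` is a.e.-measurable (a.s. limit of the measurable `U_(τ_n+t)`);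
* ★★★ `integral_mul_comp_stoppingTime_add_eq_of_continuous` / `integral_mul_comp_stoppingTime_add_eq_integral_mul_transition` — **the strong
  Markov property**: for a finite stopping time `τ` (`IsStoppingTime 𝓕^W (τ : WithTop)`), `Z` bounded and `𝓕_τ`-measurable, `G` bounded measurable,
  `∫ Z·G(U_(τ+t)) dP = ∫ Z·(∫ G dκ_t(U_τ)) dP`.
THEOREMS ONLY, no definition, no sorry; [folklore] / Revuz–Yor III Thm (3.1) for this SDE.  HONEST FRAMING: fixed cut-off; structural plumbing;
`UniformColdStartMixing` (24809) is NOT restated; no crux, rung or summit statement is proved; the Yang–Mills mass gap is NOT proved.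
-/

set_option autoImplicit false

noncomputable section

namespace Summit.QuantumFields.YangMills.Theorems.ColdStartUniversality

open MeasureTheory ProbabilityTheory Filter Topology
open scoped NNReal ENNReal BigOperators
open Literature Literature.Probability.Process Literature.MathematicalPhysics.QuantumFieldTheory
open Literature.MathematicalPhysics.QuantumLattice (fundamentalRep fundamentalLatticeRep continuous_fundamentalRep)

variable {L : ℕ} [NeZero L]

/-! ## §1. The dyadic ceilings of a stopping time are stopping times -/

/-- `(⌊2^n τ⌋ + 1)/2^n ≤ i ↔ τ < ⌊2^n i⌋/2^n` (all in `ℝ≥0`). [folklore] -/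
theorem dyadicCeil_le_iff (τ i : ℝ≥0) (n : ℕ) :
    ((⌊(τ : ℝ) * 2 ^ n⌋₊ + 1 : ℕ) : ℝ≥0) / 2 ^ n ≤ i ↔ τ < ((⌊(i : ℝ) * 2 ^ n⌋₊ : ℕ) : ℝ≥0) / 2 ^ n := by
  have h2 : (0 : ℝ) < 2 ^ n := by positivity
  have hτ0 : (0 : ℝ) ≤ (τ : ℝ) * 2 ^ n := by positivity
  have hi0 : (0 : ℝ) ≤ (i : ℝ) * 2 ^ n := by positivity
  rw [← NNReal.coe_le_coe, ← NNReal.coe_lt_coe, NNReal.coe_div, NNReal.coe_div, NNReal.coe_natCast, NNReal.coe_natCast,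
    NNReal.coe_pow, NNReal.coe_ofNat, div_le_iff₀ h2, lt_div_iff₀ h2]
  constructor
  · intro h
    -- `⌊τ2^n⌋ + 1 ≤ i 2^n` ⇒ `⌊τ2^n⌋ + 1 ≤ ⌊i2^n⌋` ⇒ `τ2^n < ⌊i 2^n⌋`
    have h1 : ⌊(τ : ℝ) * 2 ^ n⌋₊ + 1 ≤ ⌊(i : ℝ) * 2 ^ n⌋₊ := (Nat.le_floor_iff hi0).2 (by exact_mod_cast h)
    have h3 : ⌊(τ : ℝ) * 2 ^ n⌋₊ < ⌊(i : ℝ) * 2 ^ n⌋₊ := h1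
    exact (Nat.floor_lt hτ0).1 h3
  · intro h
    have h3 : ⌊(τ : ℝ) * 2 ^ n⌋₊ < ⌊(i : ℝ) * 2 ^ n⌋₊ := (Nat.floor_lt hτ0).2 h
    have h1 : ((⌊(τ : ℝ) * 2 ^ n⌋₊ + 1 : ℕ) : ℝ) ≤ ((⌊(i : ℝ) * 2 ^ n⌋₊ : ℕ) : ℝ) := by exact_mod_cast h3
    exact h1.trans (Nat.floor_le hi0)

/-- ★ **Dyadic ceilings of a stopping time are stopping times**: `{τ_n ≤ i} = {τ < ⌊2^n i⌋/2^n} ∈ 𝓕_(⌊2^n i⌋/2^n) ⊆ 𝓕_i`. [folklore] -/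
theorem isStoppingTime_dyadicCeil {Ω : Type*} {m : MeasurableSpace Ω} {𝓕 : Filtration ℝ≥0 m} {τ : Ω → ℝ≥0}
    (hτ : IsStoppingTime 𝓕 (fun ω => (τ ω : WithTop ℝ≥0))) (n : ℕ) :
    IsStoppingTime 𝓕 (fun ω => ((((⌊(τ ω : ℝ) * 2 ^ n⌋₊ + 1 : ℕ) : ℝ≥0) / 2 ^ n : ℝ≥0) : WithTop ℝ≥0)) := by
  intro i
  set d : ℝ≥0 := ((⌊(i : ℝ) * 2 ^ n⌋₊ : ℕ) : ℝ≥0) / 2 ^ n with hd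
  have hdi : d ≤ i := by
    rw [hd, ← NNReal.coe_le_coe, NNReal.coe_div, NNReal.coe_natCast, NNReal.coe_pow, NNReal.coe_ofNat,
      div_le_iff₀ (by positivity : (0 : ℝ) < 2 ^ n)]
    exact Nat.floor_le (by positivity)
  have hset : {ω | ((((⌊(τ ω : ℝ) * 2 ^ n⌋₊ + 1 : ℕ) : ℝ≥0) / 2 ^ n : ℝ≥0) : WithTop ℝ≥0) ≤ (i : WithTop ℝ≥0)} =
      {ω | (τ ω : WithTop ℝ≥0) < (d : WithTop ℝ≥0)} := by
    ext ω
    simp only [Set.mem_setOf_eq, WithTop.coe_le_coe, WithTop.coe_lt_coe]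
    exact dyadicCeil_le_iff (τ ω) i n
  rw [hset]
  exact 𝓕.mono hdi _ (hτ.measurableSet_lt d)

/-! ## §2. The strong Markov property for continuous observables -/

/-- ★★★ **Strong Markov property, continuous observable.**  For every strong solution `U` from a deterministic start on any space, every finite
stopping time `τ` of the driving filtration, every bounded `𝓕_τ`-measurable `Z` and every continuous `G`:
`∫ Z·G(U_(τ+t)) dP = ∫ Z·(∫ G dκ_t(U_τ)) dP` (file 57 at the dyadic ceilings `τ_n ↓ τ`, a.s. path continuity, Feller). [cite: RevuzYor1999, Ch. III Thm (3.1)] -/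
theorem integral_mul_comp_stoppingTime_add_eq_of_continuous (β' : ℝ)
    (κ : ℝ≥0 → Kernel (GaugeConfig 3 L (Matrix.specialUnitaryGroup (Fin 2) ℂ))
      (GaugeConfig 3 L (Matrix.specialUnitaryGroup (Fin 2) ℂ))) [∀ t, IsMarkovKernel (κ t)]
    (hreal : ∀ (t : ℝ≥0) (x : GaugeConfig 3 L (Matrix.specialUnitaryGroup (Fin 2) ℂ))
        (Ω : Type) [MeasurableSpace Ω] (P : Measure Ω) [IsProbabilityMeasure P]
        (W : ℝ≥0 → Ω → (Edge 3 L × NoiseIdx 2 → ℝ)) (hW : IsFlatBrownian W P)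
        (U : ℝ≥0 → Ω → GaugeConfig 3 L (Matrix.specialUnitaryGroup (Fin 2) ℂ)),
        (∀ ω, U 0 ω = x) →
        (latticeLangevinDynamics (fundamentalLatticeRep 2) β').IsSolution (fundamentalRep (Fin 2))
          hW.natFiltration P W U →
        κ t x = P.map (U t))
    (x : GaugeConfig 3 L (Matrix.specialUnitaryGroup (Fin 2) ℂ))
    {Ω : Type} [MeasurableSpace Ω] {P : Measure Ω} [IsProbabilityMeasure P]
    {W : ℝ≥0 → Ω → (Edge 3 L × NoiseIdx 2 → ℝ)} (hW : IsFlatBrownian W P)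
    {U : ℝ≥0 → Ω → GaugeConfig 3 L (Matrix.specialUnitaryGroup (Fin 2) ℂ)} (hU0 : ∀ ω, U 0 ω = x)
    (hU : (latticeLangevinDynamics (fundamentalLatticeRep 2) β').IsSolution (fundamentalRep (Fin 2)) hW.natFiltration P W U)
    {τ : Ω → ℝ≥0} (hτ : IsStoppingTime hW.natFiltration (fun ω => (τ ω : WithTop ℝ≥0))) (t : ℝ≥0)
    {Z : Ω → ℝ} (hZ : Measurable[hτ.measurableSpace] Z) {CZ : ℝ} (hZb : ∀ ω, |Z ω| ≤ CZ)
    {G : GaugeConfig 3 L (Matrix.specialUnitaryGroup (Fin 2) ℂ) → ℝ} (hG : Continuous G) :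
    ∫ ω, Z ω * G (U (τ ω + t) ω) ∂P = ∫ ω, Z ω * (∫ z, G z ∂(κ t (U (τ ω) ω))) ∂P := by
  classical
  haveI := secondCountableTopology_su2
  haveI := borelSpace_config L
  obtain ⟨CG, hGb⟩ : ∃ CG : ℝ, ∀ z, |G z| ≤ CG := by
    set Gb := BoundedContinuousFunction.mkOfCompact ⟨G, hG⟩ with hGbdef
    exact ⟨‖Gb‖, fun z => by simpa [hGbdef, Real.norm_eq_abs] using Gb.norm_coe_le_norm z⟩
  have hGm : Measurable G := hG.measurable
  have hmU : ∀ u : ℝ≥0, Measurable (U u) := fun u => (hU.adapted u).mono (hW.natFiltration.le u) le_rfl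
  have hZm : Measurable Z := hZ.mono hτ.measurableSpace_le le_rfl
  -- the dyadic ceilings `τ_n ↓ τ`
  set τn : ℕ → Ω → ℝ≥0 := fun n ω => ((⌊(τ ω : ℝ) * 2 ^ n⌋₊ + 1 : ℕ) : ℝ≥0) / 2 ^ n with hτn
  have hτn_st : ∀ n, IsStoppingTime hW.natFiltration (fun ω => (τn n ω : WithTop ℝ≥0)) := fun n => isStoppingTime_dyadicCeil hτ n
  have hτn_ge : ∀ n ω, τ ω ≤ τn n ω := fun n ω => (le_dyadicCeil_and_le (τ ω) n).1
  have hτn_lim : ∀ ω, Tendsto (fun n => τn n ω) atTop (𝓝 (τ ω)) := fun ω => tendsto_dyadicCeil (τ ω)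
  have hτn_range : ∀ n ω, τn n ω ∈ Set.range (fun k : ℕ => ((k : ℝ≥0)) / 2 ^ n) := fun n ω => ⟨⌊(τ ω : ℝ) * 2 ^ n⌋₊ + 1, rfl⟩
  have hZn : ∀ n, Measurable[(hτn_st n).measurableSpace] Z := fun n =>
    hZ.mono (IsStoppingTime.measurableSpace_mono hτ (hτn_st n) fun ω => WithTop.coe_le_coe.2 (hτn_ge n ω)) le_rfl
  -- file 57 at each `τ_n`
  have hstep : ∀ n, ∫ ω, Z ω * G (U (τn n ω + t) ω) ∂P = ∫ ω, Z ω * (∫ z, G z ∂(κ t (U (τn n ω) ω))) ∂P := fun n =>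
    integral_mul_comp_stoppingTime_add_eq β' κ hreal x hW hU0 hU (hτn_st n) (Set.countable_range _) (hτn_range n) t (hZn n) hZb hGm hGb
  -- measurability of the approximants
  have hlev : ∀ n, ∀ s ∈ Set.range (fun k : ℕ => ((k : ℝ≥0)) / 2 ^ n), MeasurableSet {ω | τn n ω = s} := fun n s _ =>
    (hW.natFiltration.le s) _ (measurableSet_eq_of_isStoppingTime (hτn_st n) s)
  have hUn : ∀ n, Measurable fun ω => U (τn n ω + t) ω := fun n =>
    measurable_comp_countableStoppingTime hmU (Set.countable_range _) (hτn_range n) (hlev n) t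
  have hUn0 : ∀ n, Measurable fun ω => U (τn n ω) ω := fun n => by
    have h := measurable_comp_countableStoppingTime hmU (Set.countable_range _) (hτn_range n) (hlev n) 0
    simpa only [add_zero] using h
  -- Feller and bounds
  have hF : Continuous fun y => ∫ z, G z ∂(κ t y) := continuous_integral_transitionKernel L β' κ hreal t hG
  have hFb : ∀ y, |∫ z, G z ∂(κ t y)| ≤ CG := fun y => by
    have hh := norm_integral_le_of_norm_le_const (μ := κ t y) (f := G) (C := CG)
      (Eventually.of_forall fun z => by simpa [Real.norm_eq_abs] using hGb z)
    simpa [Real.norm_eq_abs] using hh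
  -- the two limits along `n → ∞`
  have hL : Tendsto (fun n => ∫ ω, Z ω * G (U (τn n ω + t) ω) ∂P) atTop (𝓝 (∫ ω, Z ω * G (U (τ ω + t) ω) ∂P)) := by
    refine tendsto_integral_of_dominated_convergence (fun _ => |CZ| * CG)
      (fun n => (hZm.mul (hGm.comp (hUn n))).aestronglyMeasurable) (integrable_const _)
      (fun n => Eventually.of_forall fun ω => by
        rw [norm_mul, Real.norm_eq_abs, Real.norm_eq_abs]
        exact mul_le_mul ((hZb ω).trans (le_abs_self CZ)) (hGb _) (abs_nonneg _) (abs_nonneg _)) ?_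
    filter_upwards [hU.continuous] with ω hω
    exact ((hG.tendsto _).comp ((hω.tendsto _).comp ((hτn_lim ω).add tendsto_const_nhds))).const_mul (Z ω)
  have hR : Tendsto (fun n => ∫ ω, Z ω * (∫ z, G z ∂(κ t (U (τn n ω) ω))) ∂P) atTop
      (𝓝 (∫ ω, Z ω * (∫ z, G z ∂(κ t (U (τ ω) ω))) ∂P)) := by
    refine tendsto_integral_of_dominated_convergence (fun _ => |CZ| * CG)
      (fun n => (hZm.mul (hF.measurable.comp (hUn0 n))).aestronglyMeasurable) (integrable_const _)
      (fun n => Eventually.of_forall fun ω => by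
        rw [norm_mul, Real.norm_eq_abs, Real.norm_eq_abs]
        exact mul_le_mul ((hZb ω).trans (le_abs_self CZ)) (hFb _) (abs_nonneg _) (abs_nonneg _)) ?_
    filter_upwards [hU.continuous] with ω hω
    exact ((hF.tendsto _).comp ((hω.tendsto _).comp (hτn_lim ω))).const_mul (Z ω)
  have hLR : (fun n => ∫ ω, Z ω * G (U (τn n ω + t) ω) ∂P) = fun n => ∫ ω, Z ω * (∫ z, G z ∂(κ t (U (τn n ω) ω))) ∂P :=
    funext hstep
  rw [hLR] at hL
  exact tendsto_nhds_unique hL hR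

/-! ## §3. The strong Markov property for bounded measurable observables -/

/-- `ω ↦ U_(τ(ω) + t)(ω)` is a.e.-measurable for every finite stopping time `τ` (a.s. limit of the measurable `U_(τ_n + t)`). [folklore] -/
theorem aemeasurable_comp_stoppingTime_add (β' : ℝ) (x : GaugeConfig 3 L (Matrix.specialUnitaryGroup (Fin 2) ℂ))
    {Ω : Type} [MeasurableSpace Ω] {P : Measure Ω} [IsProbabilityMeasure P]
    {W : ℝ≥0 → Ω → (Edge 3 L × NoiseIdx 2 → ℝ)} (hW : IsFlatBrownian W P)
    {U : ℝ≥0 → Ω → GaugeConfig 3 L (Matrix.specialUnitaryGroup (Fin 2) ℂ)} (hU0 : ∀ ω, U 0 ω = x)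
    (hU : (latticeLangevinDynamics (fundamentalLatticeRep 2) β').IsSolution (fundamentalRep (Fin 2)) hW.natFiltration P W U)
    {τ : Ω → ℝ≥0} (hτ : IsStoppingTime hW.natFiltration (fun ω => (τ ω : WithTop ℝ≥0))) (t : ℝ≥0) :
    AEMeasurable (fun ω => U (τ ω + t) ω) P := by
  classical
  haveI := secondCountableTopology_su2
  haveI := borelSpace_config L
  haveI := polishSpace_config L
  have hmU : ∀ u : ℝ≥0, Measurable (U u) := fun u => (hU.adapted u).mono (hW.natFiltration.le u) le_rfl
  set τn : ℕ → Ω → ℝ≥0 := fun n ω => ((⌊(τ ω : ℝ) * 2 ^ n⌋₊ + 1 : ℕ) : ℝ≥0) / 2 ^ n with hτn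
  have hτn_st : ∀ n, IsStoppingTime hW.natFiltration (fun ω => (τn n ω : WithTop ℝ≥0)) := fun n => isStoppingTime_dyadicCeil hτ n
  have hτn_range : ∀ n ω, τn n ω ∈ Set.range (fun k : ℕ => ((k : ℝ≥0)) / 2 ^ n) := fun n ω => ⟨⌊(τ ω : ℝ) * 2 ^ n⌋₊ + 1, rfl⟩
  have hlev : ∀ n, ∀ s ∈ Set.range (fun k : ℕ => ((k : ℝ≥0)) / 2 ^ n), MeasurableSet {ω | τn n ω = s} := fun n s _ =>
    (hW.natFiltration.le s) _ (measurableSet_eq_of_isStoppingTime (hτn_st n) s)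
  have hUn : ∀ n, Measurable fun ω => U (τn n ω + t) ω := fun n =>
    measurable_comp_countableStoppingTime hmU (Set.countable_range _) (hτn_range n) (hlev n) t
  refine aemeasurable_of_tendsto_metrizable_ae atTop (fun n => (hUn n).aemeasurable) ?_
  filter_upwards [hU.continuous] with ω hω
  have _h0 := hU0 ω
  exact (hω.tendsto _).comp ((tendsto_dyadicCeil (τ ω)).add tendsto_const_nhds)

/-- ★★★ **THE STRONG MARKOV PROPERTY OF STRONG SOLUTIONS OF THE SZZ DYNAMICS.**  For every coupling, every Markov kernel family `κ` realising the
transition laws, EVERY strong solution `U` from a deterministic start `x` on ANY probability space with flat Brownian driver `W`, every FINITE STOPPING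
TIME `τ` of `σ(W_u : u ≤ ·)`, every lattice time `t`, every bounded `Z` measurable for the `τ`-past `𝓕_τ` and every bounded measurable `G`:
`∫ Z · G(U_(τ+t)) dP = ∫ Z · (∫ G dκ_t(U_τ)) dP`. [cite: RevuzYor1999, Ch. III Thm (3.1)] -/
theorem integral_mul_comp_stoppingTime_add_eq_integral_mul_transition (β' : ℝ)
    (κ : ℝ≥0 → Kernel (GaugeConfig 3 L (Matrix.specialUnitaryGroup (Fin 2) ℂ))
      (GaugeConfig 3 L (Matrix.specialUnitaryGroup (Fin 2) ℂ))) [∀ t, IsMarkovKernel (κ t)]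
    (hreal : ∀ (t : ℝ≥0) (x : GaugeConfig 3 L (Matrix.specialUnitaryGroup (Fin 2) ℂ))
        (Ω : Type) [MeasurableSpace Ω] (P : Measure Ω) [IsProbabilityMeasure P]
        (W : ℝ≥0 → Ω → (Edge 3 L × NoiseIdx 2 → ℝ)) (hW : IsFlatBrownian W P)
        (U : ℝ≥0 → Ω → GaugeConfig 3 L (Matrix.specialUnitaryGroup (Fin 2) ℂ)),
        (∀ ω, U 0 ω = x) →
        (latticeLangevinDynamics (fundamentalLatticeRep 2) β').IsSolution (fundamentalRep (Fin 2))
          hW.natFiltration P W U →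
        κ t x = P.map (U t))
    (x : GaugeConfig 3 L (Matrix.specialUnitaryGroup (Fin 2) ℂ))
    {Ω : Type} [MeasurableSpace Ω] {P : Measure Ω} [IsProbabilityMeasure P]
    {W : ℝ≥0 → Ω → (Edge 3 L × NoiseIdx 2 → ℝ)} (hW : IsFlatBrownian W P)
    {U : ℝ≥0 → Ω → GaugeConfig 3 L (Matrix.specialUnitaryGroup (Fin 2) ℂ)} (hU0 : ∀ ω, U 0 ω = x)
    (hU : (latticeLangevinDynamics (fundamentalLatticeRep 2) β').IsSolution (fundamentalRep (Fin 2)) hW.natFiltration P W U)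
    {τ : Ω → ℝ≥0} (hτ : IsStoppingTime hW.natFiltration (fun ω => (τ ω : WithTop ℝ≥0))) (t : ℝ≥0)
    {Z : Ω → ℝ} (hZ : Measurable[hτ.measurableSpace] Z) {CZ : ℝ} (hZb : ∀ ω, |Z ω| ≤ CZ)
    {G : GaugeConfig 3 L (Matrix.specialUnitaryGroup (Fin 2) ℂ) → ℝ} (hG : Measurable G) {CG : ℝ} (hGb : ∀ z, |G z| ≤ CG) :
    ∫ ω, Z ω * G (U (τ ω + t) ω) ∂P = ∫ ω, Z ω * (∫ z, G z ∂(κ t (U (τ ω) ω))) ∂P := by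
  classical
  haveI := secondCountableTopology_su2
  haveI := borelSpace_config L
  haveI := polishSpace_config L
  have hZm : Measurable Z := hZ.mono hτ.measurableSpace_le le_rfl
  have hVt : AEMeasurable (fun ω => U (τ ω + t) ω) P := aemeasurable_comp_stoppingTime_add β' x hW hU0 hU hτ t
  have hV0 : AEMeasurable (fun ω => U (τ ω) ω) P := by
    have h := aemeasurable_comp_stoppingTime_add β' x hW hU0 hU hτ 0
    simpa only [add_zero] using h
  have hκm : ∀ {φ : GaugeConfig 3 L (Matrix.specialUnitaryGroup (Fin 2) ℂ) → ℝ}, Measurable φ →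
      Measurable fun y => ∫ z, φ z ∂(κ t y) := fun hφ => (hφ.stronglyMeasurable.integral_kernel (κ := κ t)).measurable
  -- reduction to a non-negative weight: the identity for `Z' = Z + CZ ≥ 0` and for the constant `CZ`
  suffices key : ∀ {Z' : Ω → ℝ}, Measurable[hτ.measurableSpace] Z' → (∀ ω, 0 ≤ Z' ω) → ∀ {C' : ℝ}, (∀ ω, |Z' ω| ≤ C') →
      ∫ ω, Z' ω * G (U (τ ω + t) ω) ∂P = ∫ ω, Z' ω * (∫ z, G z ∂(κ t (U (τ ω) ω))) ∂P by
    have hZ' : Measurable[hτ.measurableSpace] fun ω => Z ω + CZ := hZ.add_const CZ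
    have hZ'0 : ∀ ω, 0 ≤ Z ω + CZ := fun ω => by linarith [(abs_le.1 (hZb ω)).1]
    have hZ'b : ∀ ω, |Z ω + CZ| ≤ CZ + |CZ| := fun ω => (abs_add_le _ _).trans (add_le_add (hZb ω) le_rfl)
    have hC0 : ∀ ω : Ω, 0 ≤ CZ := fun ω => (abs_nonneg _).trans (hZb ω)
    have h1 := key hZ' hZ'0 hZ'b
    have h2 := key (@measurable_const _ _ _ hτ.measurableSpace CZ) hC0 (C' := |CZ|) (fun _ => le_rfl)
    have hκGb : ∀ y, |∫ z, G z ∂(κ t y)| ≤ CG := fun y => by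
      have h := norm_integral_le_of_norm_le_const (μ := κ t y) (f := G) (C := CG)
        (Eventually.of_forall fun z => by simpa [Real.norm_eq_abs] using hGb z)
      simpa [Real.norm_eq_abs] using h
    have hInt : ∀ {φ ψ : Ω → ℝ} {Cφ Cψ : ℝ}, Measurable φ → AEMeasurable ψ P → (∀ ω, |φ ω| ≤ Cφ) → (∀ ω, |ψ ω| ≤ Cψ) →
        Integrable (fun ω => φ ω * ψ ω) P := fun hφ hψ hφb hψb =>
      (integrable_const _).mono' (hφ.aemeasurable.mul hψ).aestronglyMeasurable (Eventually.of_forall fun ω => by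
        rw [norm_mul, Real.norm_eq_abs, Real.norm_eq_abs]
        exact mul_le_mul (hφb ω) (hψb ω) (abs_nonneg _) ((abs_nonneg _).trans (hφb ω)))
    have i1 : Integrable (fun ω => (Z ω + CZ) * G (U (τ ω + t) ω)) P :=
      hInt (hZm.add_const CZ) (hG.comp_aemeasurable hVt) hZ'b (fun ω => hGb _)
    have i2 : Integrable (fun ω => CZ * G (U (τ ω + t) ω)) P :=
      hInt measurable_const (hG.comp_aemeasurable hVt) (fun _ => le_rfl) (fun ω => hGb _)
    have i3 : Integrable (fun ω => (Z ω + CZ) * (∫ z, G z ∂(κ t (U (τ ω) ω)))) P :=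
      hInt (hZm.add_const CZ) ((hκm hG).comp_aemeasurable hV0) hZ'b (fun ω => hκGb _)
    have i4 : Integrable (fun ω => CZ * (∫ z, G z ∂(κ t (U (τ ω) ω)))) P :=
      hInt measurable_const ((hκm hG).comp_aemeasurable hV0) (fun _ => le_rfl) (fun ω => hκGb _)
    have eL : ∫ ω, Z ω * G (U (τ ω + t) ω) ∂P = (∫ ω, (Z ω + CZ) * G (U (τ ω + t) ω) ∂P) - ∫ ω, CZ * G (U (τ ω + t) ω) ∂P := by
      rw [← integral_sub i1 i2]; exact integral_congr_ae (ae_of_all _ fun ω => by ring)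
    have eR : ∫ ω, Z ω * (∫ z, G z ∂(κ t (U (τ ω) ω))) ∂P =
        (∫ ω, (Z ω + CZ) * (∫ z, G z ∂(κ t (U (τ ω) ω))) ∂P) - ∫ ω, CZ * (∫ z, G z ∂(κ t (U (τ ω) ω))) ∂P := by
      rw [← integral_sub i3 i4]; exact integral_congr_ae (ae_of_all _ fun ω => by ring)
    rw [eL, eR, h1, h2]
  -- the non-negative case: two finite measures agreeing on bounded continuous functions
  intro Z' hZ' hZ'0 C' hZ'b
  have hZ'm : Measurable Z' := hZ'.mono hτ.measurableSpace_le le_rfl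
  set μZ : Measure Ω := P.withDensity fun ω => ENNReal.ofReal (Z' ω) with hμZ
  haveI : IsFiniteMeasure μZ := by
    refine isFiniteMeasure_withDensity_ofReal ?_
    exact ((integrable_const C').mono' hZ'm.aestronglyMeasurable
      (Eventually.of_forall fun ω => by simpa [Real.norm_eq_abs] using hZ'b ω)).hasFiniteIntegral
  have hac : μZ ≪ P := withDensity_absolutelyContinuous _ _
  have hVt' : AEMeasurable (fun ω => U (τ ω + t) ω) μZ := hVt.mono_ac hac
  have hV0' : AEMeasurable (fun ω => U (τ ω) ω) μZ := hV0.mono_ac hac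
  -- `∫ h d(μZ ∘ V⁻¹) = ∫ Z'·h(V) dP`
  have hrep : ∀ {V : Ω → GaugeConfig 3 L (Matrix.specialUnitaryGroup (Fin 2) ℂ)}, AEMeasurable V μZ →
      ∀ {h : GaugeConfig 3 L (Matrix.specialUnitaryGroup (Fin 2) ℂ) → ℝ}, Measurable h →
      ∫ y, h y ∂(μZ.map V) = ∫ ω, Z' ω * h (V ω) ∂P := by
    intro V hV h hh
    rw [integral_map hV hh.aestronglyMeasurable, hμZ,
      integral_withDensity_eq_integral_toReal_smul hZ'm.ennreal_ofReal (Eventually.of_forall fun _ => ENNReal.ofReal_lt_top)]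
    refine integral_congr_ae (ae_of_all _ fun ω => ?_)
    show (ENNReal.ofReal (Z' ω)).toReal • h (V ω) = Z' ω * h (V ω)
    rw [ENNReal.toReal_ofReal (hZ'0 ω), smul_eq_mul]
  set ν₁ : Measure (GaugeConfig 3 L (Matrix.specialUnitaryGroup (Fin 2) ℂ)) := μZ.map (fun ω => U (τ ω + t) ω) with hν₁
  set ν₂ : Measure (GaugeConfig 3 L (Matrix.specialUnitaryGroup (Fin 2) ℂ)) := κ t ∘ₘ μZ.map (fun ω => U (τ ω) ω) with hν₂
  haveI : IsFiniteMeasure ν₁ := Measure.isFiniteMeasure_map _ _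
  haveI : IsFiniteMeasure (μZ.map (fun ω => U (τ ω) ω)) := Measure.isFiniteMeasure_map _ _
  haveI : IsFiniteMeasure ν₂ := by rw [hν₂]; infer_instance
  have hintν₂ : ∀ {φ : GaugeConfig 3 L (Matrix.specialUnitaryGroup (Fin 2) ℂ) → ℝ}, Measurable φ → ∀ {C : ℝ}, (∀ z, |φ z| ≤ C) →
      Integrable φ ν₂ := fun hφ C hC =>
    (integrable_const C).mono' hφ.aestronglyMeasurable (Eventually.of_forall fun z => by simpa [Real.norm_eq_abs] using hC z)
  have keyν : ν₁ = ν₂ := by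
    refine ext_of_forall_integral_eq_of_IsFiniteMeasure fun f => ?_
    obtain ⟨Cf, hCf⟩ : ∃ C : ℝ, ∀ z, |f z| ≤ C := ⟨‖f‖, fun z => by simpa [Real.norm_eq_abs] using f.norm_coe_le_norm z⟩
    rw [hν₁, hrep hVt' f.continuous.measurable, hν₂, Harris.integral_comp_measure (κ t) _ (hintν₂ f.continuous.measurable hCf),
      hrep hV0' (hκm f.continuous.measurable)]
    exact integral_mul_comp_stoppingTime_add_eq_of_continuous β' κ hreal x hW hU0 hU hτ t hZ' hZ'b f.continuous
  calc ∫ ω, Z' ω * G (U (τ ω + t) ω) ∂P = ∫ z, G z ∂ν₁ := by rw [hν₁, hrep hVt' hG]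
    _ = ∫ z, G z ∂ν₂ := by rw [keyν]
    _ = ∫ y, ∫ z, G z ∂(κ t y) ∂(μZ.map (fun ω => U (τ ω) ω)) := by rw [hν₂]; exact Harris.integral_comp_measure (κ t) _ (hintν₂ hG hGb)
    _ = ∫ ω, Z' ω * (∫ z, G z ∂(κ t (U (τ ω) ω))) ∂P := hrep hV0' (hκm hG)

end Summit.QuantumFields.YangMills.Theorems.ColdStartUniversality

end
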